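import Summits.CriticalPhenomena.PercolationContinuityZ3.Theorems.PercNearOneGluingNoHeavyLowerTailQ44SingleSourceK2K4s

/-!
# The law `K2 + K5 + K4s + ab + ac` (single-source packing, first kernel-method law) on every finite weighted graph

Support file for crux `stmt-CriticalPhenomena-4575` (master-family programme, row `Q44`), seat `prim-bnk-1` gen 27;
memo `run/shared/lean/prim/prim-l12/FROM-prim-bnk-1-gen27-SINGLE-SOURCE-ANATOMY.md` §3, §5d.

**Theorem (`pack_singleSource_N2`, all `n`).**  For every finite weighted graph on `Fin n` and all marked points,
`P(ab|cy)P(ay|bc) + P(ab|c|y)P(a|b|cy) + P(ay|bc)P(a|b|cy) + P(ab|c|y)P(a|bcy) + P(ac|b|y)P(a|bcy) ≤ [P(ab|cy)+P(abcy)]·P(a|b|c|y)`,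
i.e. the points of kinds `K2, K5, K4s` of `Q44` together with BOTH darts of source `a` are packed by the goods.  This
five-term law carries NO nine-type label certificate (memo §3: `{K2,K5,K4s}+ab+ac` is a minimal non-certifiable type
set) and its transversal GF(2) certificate is FALSE for general monotone maps (memo §5); it is proved here for graph
fibres (`pack_of_graphFibreCount`) by the kernel method: in every fibre and every nonempty subfamily `𝒮` of the points,
a c-lobe / K5-side / b-lobe of maximal size is a private type-compatible kernel (`exists_odd_good_of_subkernel`), and the
residual K2/K4s families are `exists_odd_good_K2K4s` (handshake kernel).  `fibreCount_N2` is the fibre count,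
`pack_singleSource_N2` the law.  No sorries, no definitions, standard axioms.
-/

namespace Summit.CriticalPhenomena.PercolationContinuityZ3.Theorems

namespace TwoCopyMono

open Finset FourPointAtoms KernelPeeling Literature.Probability.Percolation

variable {n : ℕ}

/-- Compatibility tables (kernel computation) for the five oriented types of the law against a c-lobe `(5;7)`, a
b-lobe `(6;7)` and — for the four types other than the c-lobe — a K5-side `(6;1)`. [this work] -/
theorem compat_tables_N2 :
    (∀ q ∈ ({(11, 8), (6, 1), (8, 1), (6, 7), (5, 7)} : Finset (Fin 15 × Fin 15)),
        upAC q.1 7 = true ∧ downBot q.2 5 = true) ∧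
    (∀ q ∈ ({(11, 8), (6, 1), (8, 1), (6, 7), (5, 7)} : Finset (Fin 15 × Fin 15)),
        upAC q.1 7 = true ∧ downBot q.2 6 = true) ∧
    (∀ q ∈ ({(11, 8), (6, 1), (8, 1), (6, 7), (5, 7)} : Finset (Fin 15 × Fin 15)), q ≠ (5, 7) →
        upAC q.1 1 = true ∧ downBot q.2 6 = true) := by
  refine ⟨?_, ?_, ?_⟩ <;> decide +kernel

/-- Containment tables: which oriented types of the law can contain a c-lobe, a K5-side, a b-lobe (cell order on both
sides). [this work] -/
theorem contain_tables_N2 :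
    (∀ q ∈ ({(11, 8), (6, 1), (8, 1), (6, 7), (5, 7)} : Finset (Fin 15 × Fin 15)),
        ple 5 q.1 = true → ple q.2 7 = true → q = (5, 7)) ∧
    (∀ q ∈ ({(11, 8), (6, 1), (8, 1), (6, 7), (5, 7)} : Finset (Fin 15 × Fin 15)),
        ple 6 q.1 = true → ple q.2 1 = true → q = (6, 1)) ∧
    (∀ q ∈ ({(11, 8), (6, 1), (8, 1), (6, 7), (5, 7)} : Finset (Fin 15 × Fin 15)),
        ple 6 q.1 = true → ple q.2 7 = true → q = (6, 7) ∨ q = (6, 1) ∨ q = (5, 7)) := by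
  refine ⟨?_, ?_, ?_⟩ <;> decide +kernel

/-- **The fibre count.**  In every graph fibre the oriented points of the law are at most the goods. [this work] -/
theorem fibreCount_N2 (a b c y : Fin n) (M C : Finset (Sym2 (Fin n)))
    (ι : Finset (Sym2 (Fin n)) → Fin 15) (hι : ∀ T : Finset (Sym2 (Fin n)), prof a b c y ↑(C ∪ T) = pp (ι T)) :
    #(M.powerset.filter fun T => (ι T, ι (M \ T)) ∈ ({(11, 8), (6, 1), (8, 1), (6, 7), (5, 7)} : Finset (Fin 15 × Fin 15))) ≤
      #(M.powerset.filter fun T => isAC (ι T) ∧ ι (M \ T) = 0) := by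
  classical
  set P : Finset (Fin 15 × Fin 15) := {(11, 8), (6, 1), (8, 1), (6, 7), (5, 7)} with hP
  set κ : Finset (Sym2 (Fin n)) → Fin 15 := fun T => ι (T ∩ M) with hκ
  have hmono : ∀ A B : Finset (Sym2 (Fin n)), A ⊆ B → ple (κ A) (κ B) = true := fun A B hAB =>
    ple_fibreMap a b c y C ι hι (Finset.inter_subset_inter hAB (subset_refl M))
  have hκS : ∀ S, S ⊆ M → κ S = ι S := fun S hS => by simp only [hκ, Finset.inter_eq_left.2 hS]
  have hκSc : ∀ S : Finset (Sym2 (Fin n)), κ Sᶜ = ι (M \ S) := fun S => by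
    simp only [hκ]; congr 1; ext e; simp [Finset.mem_sdiff, Finset.mem_inter, and_comm]
  refine card_le_card_of_oddTargets fun 𝒮 h𝒮 hne => ?_
  have h𝒮M : ∀ S ∈ 𝒮, S ⊆ M := fun S hS =>
    Finset.mem_powerset.1 (Finset.mem_filter.1 (h𝒮 hS)).1
  have htyp : ∀ S ∈ 𝒮, (ι S, ι (M \ S)) ∈ P := fun S hS => (Finset.mem_filter.1 (h𝒮 hS)).2
  -- order facts for members `S ⊇ S₀`
  have hle : ∀ S₀ ∈ 𝒮, ∀ S ∈ 𝒮, S₀ ⊆ S → ple (ι S₀) (ι S) = true ∧ ple (ι (M \ S)) (ι (M \ S₀)) = true := by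
    intro S₀ hS₀ S hS hsub
    constructor
    · have h := hmono S₀ S hsub; rwa [hκS S₀ (h𝒮M S₀ hS₀), hκS S (h𝒮M S hS)] at h
    · have h := hmono Sᶜ S₀ᶜ (Finset.compl_subset_compl.2 hsub); rwa [hκSc S, hκSc S₀] at h
  -- a private compatible member of maximal size among those of a given type gives a fat odd target
  have hcert : ∀ (h₀ l₀ : Fin 15), (∃ S ∈ 𝒮, ι S = h₀ ∧ ι (M \ S) = l₀) →
      (∀ q ∈ P, (∃ S ∈ 𝒮, (ι S, ι (M \ S)) = q) → upAC q.1 l₀ = true ∧ downBot q.2 h₀ = true) →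
      (∀ q ∈ P, (∃ S ∈ 𝒮, (ι S, ι (M \ S)) = q) → ple h₀ q.1 = true → ple q.2 l₀ = true → q = (h₀, l₀)) →
      ∃ T ∈ goods κ, Odd #(𝒮.filter (fun S => S ⊆ T)) := by
    intro h₀ l₀ hex hcompat hcont
    obtain ⟨S₀, hS₀f, hS₀max⟩ := Finset.exists_max_image (𝒮.filter (fun S => ι S = h₀ ∧ ι (M \ S) = l₀)) Finset.card
      (by obtain ⟨S, hS, h1, h2⟩ := hex; exact ⟨S, Finset.mem_filter.2 ⟨hS, h1, h2⟩⟩)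
    have hS₀ : S₀ ∈ 𝒮 := (Finset.mem_filter.1 hS₀f).1
    have hS₀t : ι S₀ = h₀ ∧ ι (M \ S₀) = l₀ := (Finset.mem_filter.1 hS₀f).2
    have hS₀M : S₀ ⊆ M := h𝒮M S₀ hS₀
    refine exists_odd_good_of_subkernel κ hmono 𝒮 (subset_refl S₀) ?_ ?_
    · intro S hS
      have hq := hcompat (ι S, ι (M \ S)) (htyp S hS) ⟨S, hS, rfl⟩
      rw [hκS S (h𝒮M S hS), hκSc S, hκS S₀ hS₀M, hκSc S₀, hS₀t.1, hS₀t.2]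
      exact hq
    · have hEq : 𝒮.filter (fun S => S₀ ⊆ S) = {S₀} := by
        ext S
        simp only [Finset.mem_filter, Finset.mem_singleton]
        constructor
        · rintro ⟨hS, hsub⟩
          obtain ⟨h1, h2⟩ := hle S₀ hS₀ S hS hsub
          rw [hS₀t.1] at h1; rw [hS₀t.2] at h2
          have hq := hcont (ι S, ι (M \ S)) (htyp S hS) ⟨S, hS, rfl⟩ h1 h2
          have hSt : ι S = h₀ ∧ ι (M \ S) = l₀ := by rw [Prod.mk.injEq] at hq; exact hq
          exact (Finset.eq_of_subset_of_card_le hsub (hS₀max S (Finset.mem_filter.2 ⟨hS, hSt⟩))).symm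
        · rintro rfl; exact ⟨hS₀, subset_refl _⟩
      rw [hEq, Finset.card_singleton]; exact odd_one
  -- a fat odd target exists
  have hfat : ∃ T ∈ goods κ, Odd #(𝒮.filter (fun S => S ⊆ T)) := by
    by_cases hc : ∃ S ∈ 𝒮, ι S = 5 ∧ ι (M \ S) = 7
    · -- a c-lobe of maximal size
      refine hcert 5 7 hc (fun q hq _ => compat_tables_N2.1 q hq) (fun q hq _ h1 h2 => contain_tables_N2.1 q hq h1 h2)
    · by_cases h5 : ∃ S ∈ 𝒮, ι S = 6 ∧ ι (M \ S) = 1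
      · -- a K5-side of maximal size (no c-lobes present)
        refine hcert 6 1 h5 (fun q hq hex => compat_tables_N2.2.2 q hq ?_) (fun q hq _ h1 h2 => contain_tables_N2.2.1 q hq h1 h2)
        rintro rfl
        obtain ⟨S, hS, hSq⟩ := hex
        rw [Prod.mk.injEq] at hSq
        exact hc ⟨S, hS, hSq.1, hSq.2⟩
      · by_cases hb : ∃ S ∈ 𝒮, ι S = 6 ∧ ι (M \ S) = 7
        · -- a b-lobe of maximal size (no c-lobes, no K5-sides present)
          refine hcert 6 7 hb (fun q hq _ => compat_tables_N2.2.1 q hq) (fun q hq hex h1 h2 => ?_)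
          rcases contain_tables_N2.2.2 q hq h1 h2 with h | h | h
          · exact h
          · exfalso; obtain ⟨S, hS, hSq⟩ := hex; rw [h, Prod.mk.injEq] at hSq
            exact h5 ⟨S, hS, hSq.1, hSq.2⟩
          · exfalso; obtain ⟨S, hS, hSq⟩ := hex; rw [h, Prod.mk.injEq] at hSq
            exact hc ⟨S, hS, hSq.1, hSq.2⟩
        · -- only K2- and K4s-sides: the handshake theorem
          refine exists_odd_good_K2K4s a b c y C M ι hι 𝒮 hne h𝒮M fun S hS => ?_
          have hq := htyp S hS
          simp only [hP, Finset.mem_insert, Finset.mem_singleton, Prod.mk.injEq] at hq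
          rcases hq with h | h | h | h | h
          · exact Or.inl h
          · exact absurd ⟨S, hS, h⟩ h5
          · exact Or.inr h
          · exact absurd ⟨S, hS, h⟩ hb
          · exact absurd ⟨S, hS, h⟩ hc
  -- thin it down to `M`
  obtain ⟨T, hT, hodd⟩ := hfat
  have hTg := (Finset.mem_filter.1 hT).2
  refine ⟨T ∩ M, Finset.mem_filter.2 ⟨Finset.mem_powerset.2 Finset.inter_subset_right, ?_, ?_⟩, ?_⟩
  · exact hTg.1
  · have h2 : M \ (T ∩ M) = Tᶜ ∩ M := by
      ext e; simp [Finset.mem_sdiff, Finset.mem_inter]; tauto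
    rw [h2]; exact hTg.2
  · have hEq : 𝒮.filter (fun S => S ⊆ T ∩ M) = 𝒮.filter (fun S => S ⊆ T) := by
      refine Finset.filter_congr fun S hS => ?_
      exact ⟨fun h => h.trans Finset.inter_subset_left, fun h => Finset.subset_inter h (h𝒮M S hS)⟩
    rw [hEq]; exact hodd

/-- **The law `K2+K5+K4s+ab+ac`, all `n`:**
`P(ab|cy)P(ay|bc) + P(ab|c|y)P(a|b|cy) + P(ay|bc)P(a|b|cy) + P(ab|c|y)P(a|bcy) + P(ac|b|y)P(a|bcy) ≤ [P(ab|cy)+P(abcy)]·P(a|b|c|y)`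
on every finite weighted graph, for all marked points. [this work] -/
theorem pack_singleSource_N2 (w : Sym2 (Fin n) → unitInterval) (a b c y : Fin n) :
    cell w a b c y 11 * cell w a b c y 8 +
      cell w a b c y 6 * cell w a b c y 1 +
      cell w a b c y 8 * cell w a b c y 1 +
      cell w a b c y 6 * cell w a b c y 7 +
      cell w a b c y 5 * cell w a b c y 7 ≤
      (cell w a b c y 11 + cell w a b c y 14) * cell w a b c y 0 := by
  have h := pack_of_graphFibreCount ({(11, 8), (6, 1), (8, 1), (6, 7), (5, 7)} : Finset (Fin 15 × Fin 15)) a b c y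
    (fun M C _ ι hι => fibreCount_N2 a b c y M C ι hι) w
  rw [Finset.sum_insert (by decide), Finset.sum_insert (by decide), Finset.sum_insert (by decide),
    Finset.sum_insert (by decide), Finset.sum_singleton] at h
  dsimp only at h
  linarith

end TwoCopyMono

end Summit.CriticalPhenomena.PercolationContinuityZ3.Theorems
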